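import Summits.HodgeConjecture.HodgeConjecture.Theorems.Ring2WeilCoverageCyclotomicRealUnits
import Mathlib.RingTheory.Polynomial.Cyclotomic.Eval
import Mathlib.Algebra.IsPrimePow
import HarnessLib

/-!
# Weil-type family coverage — the real cyclotomic units `ζ^h(1 − ζ^a)(1 − ζ^b)` of `ℚ(ζₙ)`, EVERY level `n`:
# units of `𝓞 K` fixed by conjugation with `φ_t = −4·sin(πat/n)·sin(πbt/n)` — their SIGNS are combinatorial

research route conditional on HC_CM; not a corollary; Q11.4-sentence-2 already refuted in dim ≥ 3.

Ring 2, WEIL-TYPE FAMILY-COVERAGE CENSUS (`HOME/WEIL-FAMILY-COVERAGE.md` `## b01`, blocks b01.23 (A) «explicit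
cyclotomic units exhibit the even hyperplane» and b01.28 THEOREM L (ii) «`Sig(E⁺)` ⊇ the even-weight hyperplane
at the `h = 1` levels», owner ring2-b01), part 13 of the `Ring2WeilCoverage*` series.  Parts 11/12 discharged
THEOREM L (ii) at `M = 21` with the units `(ζ^a − ζ^{−a})/(ζ − ζ^{−1})`; those units do NOT span the even
hyperplane at the even levels `28, 36, 40, 44, 48, 60, 84` (sign rank `3, 3, 3, 5, 3, 2, 5`).  This file provides,
for EVERY level `n` at once, the larger classical family (Kummer/Sinnott: `1 − ζ^a` is a unit as soon as the
order of `ζ^a` is not a prime power) in the real normalisation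
`u(a, b, h) := ζ^h·(1 − ζ^a)·(1 − ζ^b)`, `2h + a + b ≡ 0 (mod 2n)`:

* §1 `prod_one_sub_primitiveRoots_eq_one`: **`∏_{μ primitive m-th root} (1 − μ) = Φₘ(1) = 1`** for `m ≥ 2`
  not a prime power (Mathlib `eval_one_cyclotomic_not_prime_pow`); `isPrimitiveRoot_pow_div_gcd`: `ζ^a` is a
  primitive `n/gcd(n,a)`-th root; **`isUnit_one_sub_toInteger_pow`: `1 − ζ^a` is a unit of `𝓞 K`** when
  `n ∤ a` and `n/gcd(n,a)` is not a prime power (inverse `∏_{μ ≠ ζ^a} (1 − μ)`).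
* §2 `one_sub_exp_two_mul` (`1 − e^{2ix} = −2i·sin x·e^{ix}`) and **`embedding_gen_eq`: for `φ ζ = 𝐞(t)`,
  `φ(ζ^h(1 − ζ^a)(1 − ζ^b)) = −4·sin(πat/n)·sin(πbt/n)`** (the phase `e^{iπt(2h+a+b)/n} = 1`); `re_embedding_gen`:
  **`Re φ(u) < 0 ↔ (n < at mod 2n ↔ n < bt mod 2n)`**, real and non-zero (`t` a unit residue, `n ∤ a, b`).
* §3 signed products over a finite set `A` of admissible triples `(a, b, h)`: `re_embedding_prod_neg_iff` (the sign
  of `φ(± ∏_{x∈A} u(x))` is the parity of `#{x ∈ A : Re φ(u(x)) < 0} + [sign]`) and **`exists_units_coe_eq`: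
  `± ∏_{x∈A} u(x)` is a unit of `𝓞 K` FIXED BY COMPLEX CONJUGATION**.  Admissibility of `(a, b, h)` is the
  decidable conjunction `n ∤ a`, `n ∤ b`, `(2h + a + b) mod 2n = 0`, `¬IsPrimePow (n/gcd(n,a))`,
  `¬IsPrimePow (n/gcd(n,b))`.

HONEST FRAMING: elementary algebra and trigonometry for an arbitrary number field `K ∋ ζ` (primitive `n`-th root of
unity); nothing here mentions Hodge classes, `W_K` or HC; `HC_CM` is used nowhere.  No `def`, no named fact, no
`sorry`.  Part 14 (`…CyclotomicUnitSignatures`) turns sign-vector witnesses for this family into THEOREM L (ii) and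
the census's YES verdicts; parts 15 ff. supply the witnesses per level by `decide`.

References: [cite: Washington1997, §8.1 (cyclotomic units; Prop. 2.8: `1 − ζ` is a unit iff `n` is not a prime
power)]; census b01.23 (A) / b01.28 (seat-derived).
-/

noncomputable section

open Polynomial NumberField Complex Finset
open scoped Real

namespace Summit.HodgeConjecture.Ring2WeilCoverage.CyclotomicUnitProducts

open Summit.HodgeConjecture.Ring2WeilCoverage.CyclotomicSkewSigns (toCircle_coe_eq_exp two_mul_I_mul_sin)
open Summit.HodgeConjecture.Ring2WeilCoverage.CyclotomicRealUnits (sin_two_pi_mul_div_neg_iff)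
open Summit.HodgeConjecture.Ring2WeilCoverage.CMTypeSignParity (prod_pos_iff_even_card_filter_neg)
open Literature.AlgebraicGeometry.ComplexMultiplication.CyclotomicCMType (exists_apply_eq_toCircle)

variable {K : Type} [Field K] [NumberField K] {n : ℕ} [NeZero n] {ζ : K}

/-- `𝐞(t) = exp(2πi t/n) ∈ ℂ` (`ZMod.toCircle`). -/
local notation3 (prettyPrint := false) "𝐞 " t:max => ((ZMod.toCircle t : Circle) : ℂ)

/-- the generator `u(x) = ζ^h(1 − ζ^a)(1 − ζ^b)` for `x = (a, b, h)`. -/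
local notation3 (prettyPrint := false) "𝐮 " x:max =>
  (ζ ^ (x : ℕ × ℕ × ℕ).2.2 * (1 - ζ ^ (x : ℕ × ℕ × ℕ).1) * (1 - ζ ^ (x : ℕ × ℕ × ℕ).2.1))

/-- the sign predicate of `u(x)` at the unit residue `t`: `n < at mod 2n ↔ n < bt mod 2n`. -/
local notation3 (prettyPrint := false) "negAt " x:max t:max =>
  (n < (x : ℕ × ℕ × ℕ).1 * ZMod.val t % (2 * n) ↔ n < (x : ℕ × ℕ × ℕ).2.1 * ZMod.val t % (2 * n))

/-- admissibility of a triple `x = (a, b, h)`. -/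
local notation3 (prettyPrint := false) "Adm " x:max =>
  (¬ n ∣ (x : ℕ × ℕ × ℕ).1 ∧ ¬ n ∣ (x : ℕ × ℕ × ℕ).2.1 ∧
    (2 * (x : ℕ × ℕ × ℕ).2.2 + (x : ℕ × ℕ × ℕ).1 + (x : ℕ × ℕ × ℕ).2.1) % (2 * n) = 0 ∧
    ¬ IsPrimePow (n / Nat.gcd n (x : ℕ × ℕ × ℕ).1) ∧ ¬ IsPrimePow (n / Nat.gcd n (x : ℕ × ℕ × ℕ).2.1))

/-! ### §1 `1 − ζ^a` is a unit when the order of `ζ^a` is not a prime power -/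

omit [NumberField K] in
/-- **`∏_{μ ∈ primitiveRoots m K} (1 − μ) = 1`** for `m ≥ 2` not a prime power, when `K` holds a primitive `m`-th
root of unity `w` (`Φₘ = ∏ (X − μ)` and `Φₘ(1) = 1`).
research route conditional on HC_CM; not a corollary; Q11.4-sentence-2 already refuted in dim ≥ 3. [cite: Washington1997, Prop. 2.8] -/
theorem prod_one_sub_primitiveRoots_eq_one {m : ℕ} {w : K} (hw : IsPrimitiveRoot w m) (hm : 2 ≤ m)
    (hnp : ¬ IsPrimePow m) : ∏ μ ∈ primitiveRoots m K, (1 - μ) = 1 := by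
  have h1 : eval 1 (cyclotomic m K) = ∏ μ ∈ primitiveRoots m K, (1 - μ) := by
    rw [cyclotomic_eq_prod_X_sub_primitiveRoots hw, eval_prod]
    refine Finset.prod_congr rfl fun μ _ => ?_
    rw [eval_sub, eval_X, eval_C]
  rw [← h1]
  refine eval_one_cyclotomic_not_prime_pow fun {p} hp k hk => ?_
  rcases k.eq_zero_or_pos with rfl | hk0
  · rw [pow_zero] at hk; omega
  · exact hnp ⟨p, k, hp.prime, hk0, hk⟩

omit [NumberField K] [NeZero n] in
/-- `ζ^a` is a primitive `n/gcd(n,a)`-th root of unity (`a ≠ 0`).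
research route conditional on HC_CM; not a corollary; Q11.4-sentence-2 already refuted in dim ≥ 3. [folklore] -/
theorem isPrimitiveRoot_pow_div_gcd (hζ : IsPrimitiveRoot ζ n) {a : ℕ} (ha : a ≠ 0) :
    IsPrimitiveRoot (ζ ^ a) (n / Nat.gcd n a) := by
  have h := IsPrimitiveRoot.orderOf (ζ ^ a)
  rwa [orderOf_pow' ζ ha, ← hζ.eq_orderOf] at h

omit [NeZero n] in
/-- `n ∤ a` gives `n / gcd(n, a) ≥ 2` (`n ≠ 0`).
research route conditional on HC_CM; not a corollary; Q11.4-sentence-2 already refuted in dim ≥ 3. [folklore] -/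
theorem two_le_div_gcd (hn : n ≠ 0) {a : ℕ} (ha : ¬ n ∣ a) : 2 ≤ n / Nat.gcd n a := by
  have hg : Nat.gcd n a ∣ n := Nat.gcd_dvd_left n a
  have hga : Nat.gcd n a ∣ a := Nat.gcd_dvd_right n a
  have hne : Nat.gcd n a ≠ n := fun h => ha (h ▸ hga)
  have hcn : n / Nat.gcd n a * Nat.gcd n a = n := Nat.div_mul_cancel hg
  have hc0 : n / Nat.gcd n a ≠ 0 := fun h => by rw [h, zero_mul] at hcn; exact hn hcn.symm
  have hc1 : n / Nat.gcd n a ≠ 1 := fun h => by rw [h, one_mul] at hcn; exact hne hcn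
  exact Nat.two_le_iff _ |>.mpr ⟨hc0, hc1⟩

omit [NumberField K] in
/-- **`1 − ζ^a` is a unit of `𝓞 K`** when `n ∤ a` and the order `n/gcd(n,a)` of `ζ^a` is not a prime power: its
inverse is `∏_{μ ≠ ζ^a} (1 − μ)` over the other primitive roots of the same order (§1, `Φₘ(1) = 1`).
research route conditional on HC_CM; not a corollary; Q11.4-sentence-2 already refuted in dim ≥ 3. [cite: Washington1997, Prop. 2.8] -/
theorem isUnit_one_sub_toInteger_pow (hζ : IsPrimitiveRoot ζ n) {a : ℕ} (ha : ¬ n ∣ a)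
    (hnp : ¬ IsPrimePow (n / Nat.gcd n a)) : IsUnit (1 - hζ.toInteger ^ a : 𝓞 K) := by
  classical
  have ha0 : a ≠ 0 := fun h => ha (h ▸ dvd_zero n)
  set m := n / Nat.gcd n a with hm_def
  have hw : IsPrimitiveRoot (ζ ^ a) m := isPrimitiveRoot_pow_div_gcd hζ ha0
  have hm2 : 2 ≤ m := two_le_div_gcd (NeZero.ne n) ha
  have hmpos : 0 < m := by omega
  have hprod := prod_one_sub_primitiveRoots_eq_one hw hm2 hnp
  have hmem : ζ ^ a ∈ primitiveRoots m K := (mem_primitiveRoots hmpos).mpr hw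
  rw [← Finset.mul_prod_erase _ _ hmem] at hprod
  have hint : IsIntegral ℤ (∏ μ ∈ (primitiveRoots m K).erase (ζ ^ a), (1 - μ)) := by
    refine IsIntegral.prod _ fun μ hμ => ?_
    have hμ' : IsPrimitiveRoot μ m := (mem_primitiveRoots hmpos).mp (Finset.mem_of_mem_erase hμ)
    exact isIntegral_one.sub (hμ'.isIntegral hmpos)
  obtain ⟨V, hV⟩ : ∃ V : 𝓞 K, (V : K) = ∏ μ ∈ (primitiveRoots m K).erase (ζ ^ a), (1 - μ) := ⟨⟨_, hint⟩, rfl⟩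
  have hUV : (1 - hζ.toInteger ^ a) * V = 1 := by
    apply RingOfIntegers.ext
    push_cast
    refine (show (1 - ζ ^ a) * (V : K) = 1 from ?_)
    rw [hV]
    exact hprod
  exact ⟨Units.mkOfMulEqOne _ _ hUV, Units.val_mkOfMulEqOne hUV⟩

/-! ### §2 The embedding value `φ(ζ^h(1 − ζ^a)(1 − ζ^b)) = −4·sin(πat/n)·sin(πbt/n)` and its sign -/

/-- `1 − e^{2ix} = −2i·sin x·e^{ix}`.
research route conditional on HC_CM; not a corollary; Q11.4-sentence-2 already refuted in dim ≥ 3. [folklore] -/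
theorem one_sub_exp_two_mul (x : ℂ) : 1 - cexp (2 * x * I) = -(2 * I * Complex.sin x) * cexp (x * I) := by
  have h := two_mul_I_mul_sin x
  calc 1 - cexp (2 * x * I) = cexp (-x * I + x * I) - cexp (x * I + x * I) := by
        rw [show -x * I + x * I = 0 by ring, Complex.exp_zero, show x * I + x * I = 2 * x * I by ring]
    _ = (cexp (-x * I) - cexp (x * I)) * cexp (x * I) := by rw [Complex.exp_add, Complex.exp_add]; ring
    _ = -(2 * I * Complex.sin x) * cexp (x * I) := by rw [h]; ring

omit [NumberField K] in
/-- `𝐞(t)^k = exp(2·(k·πt/n)·i)`.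
research route conditional on HC_CM; not a corollary; Q11.4-sentence-2 already refuted in dim ≥ 3. [folklore] -/
theorem toCircle_pow_eq_exp_two_mul (t : ZMod n) (k : ℕ) :
    (𝐞 t) ^ k = cexp (2 * ((k : ℂ) * (π * (t.val : ℂ) / (n : ℂ))) * I) := by
  rw [toCircle_coe_eq_exp, ← Complex.exp_nat_mul]
  congr 1
  ring

omit [NumberField K] in
/-- **`φ(ζ^h(1 − ζ^a)(1 − ζ^b)) = −4·sin(πat/n)·sin(πbt/n)`** for an embedding `φ` with `φ ζ = 𝐞(t)` and
`2h + a + b ≡ 0 (mod 2n)` (the phase `e^{iπt(2h+a+b)/n}` is `1`).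
research route conditional on HC_CM; not a corollary; Q11.4-sentence-2 already refuted in dim ≥ 3. [cite: Washington1997, §8.1] -/
theorem embedding_gen_eq {φ : K →+* ℂ} {t : ZMod n} (hφ : φ ζ = 𝐞 t) {a b h : ℕ}
    (hh : (2 * h + a + b) % (2 * n) = 0) :
    φ (ζ ^ h * (1 - ζ ^ a) * (1 - ζ ^ b)) =
      ((-4 * Real.sin (π * ((a * t.val : ℕ) : ℝ) / n) * Real.sin (π * ((b * t.val : ℕ) : ℝ) / n) : ℝ) : ℂ) := by
  have hdm := Nat.div_add_mod (2 * h + a + b) (2 * n)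
  rw [hh, add_zero] at hdm
  obtain ⟨q, hq⟩ : ∃ q, 2 * h + a + b = 2 * n * q := ⟨(2 * h + a + b) / (2 * n), hdm.symm⟩
  set θ : ℂ := π * (t.val : ℂ) / (n : ℂ) with hθ
  simp only [map_mul, map_sub, map_one, map_pow, hφ]
  rw [toCircle_pow_eq_exp_two_mul t a, toCircle_pow_eq_exp_two_mul t b, one_sub_exp_two_mul,
    one_sub_exp_two_mul, toCircle_pow_eq_exp_two_mul t h]
  have hphase : cexp (2 * ((h : ℂ) * θ) * I) * cexp ((a : ℂ) * θ * I) * cexp ((b : ℂ) * θ * I) = 1 := by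
    rw [← Complex.exp_add, ← Complex.exp_add]
    have hn0 : (n : ℂ) ≠ 0 := Nat.cast_ne_zero.mpr (NeZero.ne n)
    have : 2 * ((h : ℂ) * θ) * I + (a : ℂ) * θ * I + (b : ℂ) * θ * I = ((q * t.val : ℕ) : ℂ) * (2 * π * I) := by
      calc 2 * ((h : ℂ) * θ) * I + (a : ℂ) * θ * I + (b : ℂ) * θ * I = ((2 * h + a + b : ℕ) : ℂ) * θ * I := by
            push_cast; ring
        _ = ((2 * n * q : ℕ) : ℂ) * θ * I := by rw [hq]
        _ = ((q * t.val : ℕ) : ℂ) * (2 * π * I) := by rw [hθ]; push_cast; field_simp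
    rw [this]
    exact Complex.exp_nat_mul_two_pi_mul_I _
  have hsa : Complex.sin ((a : ℂ) * θ) = ((Real.sin (π * ((a * t.val : ℕ) : ℝ) / n) : ℝ) : ℂ) := by
    rw [Complex.ofReal_sin]; congr 1; rw [hθ]; push_cast; ring
  have hsb : Complex.sin ((b : ℂ) * θ) = ((Real.sin (π * ((b * t.val : ℕ) : ℝ) / n) : ℝ) : ℂ) := by
    rw [Complex.ofReal_sin]; congr 1; rw [hθ]; push_cast; ring
  calc cexp (2 * ((h : ℂ) * θ) * I) * (-(2 * I * Complex.sin ((a : ℂ) * θ)) * cexp ((a : ℂ) * θ * I)) *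
        (-(2 * I * Complex.sin ((b : ℂ) * θ)) * cexp ((b : ℂ) * θ * I))
      = (I * I) * 4 * Complex.sin ((a : ℂ) * θ) * Complex.sin ((b : ℂ) * θ) *
          (cexp (2 * ((h : ℂ) * θ) * I) * cexp ((a : ℂ) * θ * I) * cexp ((b : ℂ) * θ * I)) := by ring
    _ = _ := by rw [hphase, Complex.I_mul_I, hsa, hsb]; push_cast; ring

omit [NumberField K] in
/-- **The sign of one factor**: for a unit residue `t` and `n ∤ c`, `sin(π·ct/n) < 0 ↔ n < ct mod 2n`, and the
sine is non-zero (`n ∤ ct`).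
research route conditional on HC_CM; not a corollary; Q11.4-sentence-2 already refuted in dim ≥ 3. [folklore] -/
theorem sin_pi_mul_div_neg_iff {t : ZMod n} (ht : t.val.Coprime n) {c : ℕ} (hc : ¬ n ∣ c) :
    (Real.sin (π * ((c * t.val : ℕ) : ℝ) / n) < 0 ↔ n < c * t.val % (2 * n)) ∧
      Real.sin (π * ((c * t.val : ℕ) : ℝ) / n) ≠ 0 := by
  have hnpos : 0 < n := NeZero.pos n
  have hndvd : ¬ n ∣ c * t.val := fun h => hc (ht.symm.dvd_of_dvd_mul_right h)
  have h0 : c * t.val % (2 * n) ≠ 0 := fun h =>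
    hndvd (Nat.dvd_trans ⟨2, by ring⟩ (Nat.dvd_of_mod_eq_zero h))
  have h2 : 2 * (c * t.val % (2 * n)) ≠ 2 * n := by
    intro h
    have hmod : c * t.val % (2 * n) = n := by omega
    apply hndvd
    rw [← Nat.div_add_mod (c * t.val) (2 * n), hmod]
    exact ⟨2 * (c * t.val / (2 * n)) + 1, by ring⟩
  obtain ⟨hiff, hne⟩ := sin_two_pi_mul_div_neg_iff (m := c * t.val) (n := 2 * n) (by omega) h0 h2
  have hrw : Real.sin (2 * π * ((c * t.val : ℕ) : ℝ) / ((2 * n : ℕ) : ℝ)) =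
      Real.sin (π * ((c * t.val : ℕ) : ℝ) / n) := by
    congr 1
    have hn0 : (n : ℝ) ≠ 0 := Nat.cast_ne_zero.mpr (NeZero.ne n)
    push_cast
    field_simp
  rw [hrw] at hiff hne
  refine ⟨?_, hne⟩
  rw [hiff]
  omega

omit [NumberField K] in
/-- **`Re φ(u(a,b,h)) < 0 ↔ (n < at mod 2n ↔ n < bt mod 2n)`** — `u = ζ^h(1 − ζ^a)(1 − ζ^b)` is NEGATIVE at the
place reading the unit residue `t` iff the two sines `sin(πat/n)`, `sin(πbt/n)` have the same sign — and
`φ(u)` is a NON-ZERO REAL number (`n ∤ a`, `n ∤ b`, `2h + a + b ≡ 0 (mod 2n)`).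
research route conditional on HC_CM; not a corollary; Q11.4-sentence-2 already refuted in dim ≥ 3. [folklore] -/
theorem re_embedding_gen {φ : K →+* ℂ} {t : ZMod n} (hφ : φ ζ = 𝐞 t) (ht : t.val.Coprime n) {a b h : ℕ}
    (ha : ¬ n ∣ a) (hb : ¬ n ∣ b) (hh : (2 * h + a + b) % (2 * n) = 0) :
    ((φ (ζ ^ h * (1 - ζ ^ a) * (1 - ζ ^ b))).re < 0 ↔
        (n < a * t.val % (2 * n) ↔ n < b * t.val % (2 * n))) ∧
      (φ (ζ ^ h * (1 - ζ ^ a) * (1 - ζ ^ b))).re ≠ 0 ∧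
      (φ (ζ ^ h * (1 - ζ ^ a) * (1 - ζ ^ b))).im = 0 := by
  rw [embedding_gen_eq hφ hh, Complex.ofReal_re, Complex.ofReal_im]
  obtain ⟨hsa, hsa0⟩ := sin_pi_mul_div_neg_iff ht ha
  obtain ⟨hsb, hsb0⟩ := sin_pi_mul_div_neg_iff ht hb
  set sa := Real.sin (π * ((a * t.val : ℕ) : ℝ) / n)
  set sb := Real.sin (π * ((b * t.val : ℕ) : ℝ) / n)
  refine ⟨?_, by simp [hsa0, hsb0], rfl⟩
  rw [← hsa, ← hsb, show (-4 : ℝ) * sa * sb = -(4 * (sa * sb)) by ring, neg_lt_zero,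
    mul_pos_iff_of_pos_left (by norm_num : (0:ℝ) < 4), mul_pos_iff]
  have ha' : 0 < sa ↔ ¬ sa < 0 := ⟨fun h h' => lt_asymm h h', fun h => lt_of_le_of_ne (not_lt.mp h) hsa0.symm⟩
  have hb' : 0 < sb ↔ ¬ sb < 0 := ⟨fun h h' => lt_asymm h h', fun h => lt_of_le_of_ne (not_lt.mp h) hsb0.symm⟩
  rw [ha', hb']
  tauto

/-! ### §3 Signed products of admissible generators -/

omit [NumberField K] in
/-- **Sign of a signed product**: for a finite set `A` of triples `(a, b, h)` with `n ∤ a, b`,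
`2h + a + b ≡ 0 (mod 2n)`, a sign `ε`, and `φ ζ = 𝐞(t)` (`t` a unit residue):
`Re φ(± ∏_{x∈A} u(x)) < 0 ↔ #{x ∈ A : (n < a_x t mod 2n ↔ n < b_x t mod 2n)} + [ε]` is odd; and the real part
is non-zero.  (All `φ(u(x))` are real; part 1's `prod_pos_iff_even_card_filter_neg`.)
research route conditional on HC_CM; not a corollary; Q11.4-sentence-2 already refuted in dim ≥ 3. [folklore] -/
theorem re_embedding_prod_neg_iff {φ : K →+* ℂ} {t : ZMod n} (hφ : φ ζ = 𝐞 t) (ht : t.val.Coprime n)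
    (A : Finset (ℕ × ℕ × ℕ))
    (hA : ∀ x ∈ A, ¬ n ∣ x.1 ∧ ¬ n ∣ x.2.1 ∧ (2 * x.2.2 + x.1 + x.2.1) % (2 * n) = 0) (ε : Bool) :
    ((φ ((if ε then -1 else 1) * ∏ x ∈ A, 𝐮 x)).re < 0 ↔
        Odd ((A.filter fun x => negAt x t).card + (if ε then 1 else 0))) ∧
      (φ ((if ε then -1 else 1) * ∏ x ∈ A, 𝐮 x)).re ≠ 0 := by
  have hgen : ∀ x ∈ A, ((φ (𝐮 x)).re < 0 ↔ negAt x t) ∧ (φ (𝐮 x)).re ≠ 0 ∧ (φ (𝐮 x)).im = 0 :=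
    fun x hx => re_embedding_gen hφ ht (hA x hx).1 (hA x hx).2.1 (hA x hx).2.2
  have hreal : ∀ x ∈ A, φ (𝐮 x) = (((φ (𝐮 x)).re : ℝ) : ℂ) := fun x hx =>
    Complex.ext (by simp) (by rw [Complex.ofReal_im]; exact (hgen x hx).2.2)
  have hprod : φ (∏ x ∈ A, 𝐮 x) = ((∏ x ∈ A, (φ (𝐮 x)).re : ℝ) : ℂ) := by
    rw [map_prod, Complex.ofReal_prod]
    exact Finset.prod_congr rfl hreal
  have hne : ∀ x ∈ A, (φ (𝐮 x)).re ≠ 0 := fun x hx => (hgen x hx).2.1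
  have hP : ∏ x ∈ A, (φ (𝐮 x)).re ≠ 0 := Finset.prod_ne_zero_iff.mpr hne
  have hpos := prod_pos_iff_even_card_filter_neg A (fun x => (φ (𝐮 x)).re) hne
  have hfilter : (A.filter fun x => (φ (𝐮 x)).re < 0) = A.filter fun x => negAt x t :=
    Finset.filter_congr fun x hx => (hgen x hx).1
  rw [hfilter] at hpos
  rw [map_mul, hprod]
  cases ε
  · simp only [Bool.false_eq_true, ↓reduceIte, map_one, one_mul, Complex.ofReal_re, add_zero]
    refine ⟨?_, hP⟩
    rw [← Nat.not_even_iff_odd, ← hpos, not_lt]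
    exact ⟨fun h => h.le, fun h => lt_of_le_of_ne h hP⟩
  · simp only [↓reduceIte, map_neg, map_one, neg_mul, one_mul, Complex.neg_re, Complex.ofReal_re, neg_lt_zero,
      ne_eq, neg_eq_zero]
    refine ⟨?_, hP⟩
    rw [hpos, Nat.odd_add_one, Nat.not_odd_iff_even]

/-- **`± ∏_{x∈A} ζ^{h_x}(1 − ζ^{a_x})(1 − ζ^{b_x})` is a unit of `𝓞 K` fixed by complex conjugation** for a finite
set `A` of ADMISSIBLE triples (`n ∤ a, b`; `2h + a + b ≡ 0 (mod 2n)`; the orders `n/gcd(n,a)`, `n/gcd(n,b)` of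
`ζ^a`, `ζ^b` are not prime powers), `K` a CM field containing the primitive `n`-th root of unity `ζ`: each factor
`1 − ζ^a` is a unit by §1, `ζ^h` is a unit, and reality is read through an embedding (every `φ(u(x))` is real, §2).
research route conditional on HC_CM; not a corollary; Q11.4-sentence-2 already refuted in dim ≥ 3. [cite: Washington1997, §8.1, Prop. 2.8] -/
theorem exists_units_coe_eq [IsCMField K] (hζ : IsPrimitiveRoot ζ n) {A : Finset (ℕ × ℕ × ℕ)}
    (hA : ∀ x ∈ A, Adm x) (ε : Bool) :
    ∃ u : (𝓞 K)ˣ, ((u : 𝓞 K) : K) = (if ε then -1 else 1) * ∏ x ∈ A, 𝐮 x ∧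
      IsCMField.complexConj K ((u : 𝓞 K) : K) = ((u : 𝓞 K) : K) := by
  classical
  -- the element of `𝓞 K` and its image in `K`
  set U : 𝓞 K := (if ε then -1 else 1) *
    ∏ x ∈ A, (hζ.toInteger ^ x.2.2 * (1 - hζ.toInteger ^ x.1) * (1 - hζ.toInteger ^ x.2.1)) with hUdef
  have hUK : (U : K) = (if ε then -1 else 1) * ∏ x ∈ A, 𝐮 x := by
    rw [hUdef]; cases ε <;> push_cast <;> rfl
  -- it is a unit: each factor is
  have hζU : IsUnit (hζ.toInteger : 𝓞 K) := hζ.toInteger_isPrimitiveRoot.isUnit (NeZero.ne n)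
  have hU : IsUnit U := by
    refine IsUnit.mul (by cases ε <;> simp) ?_
    refine Finset.prod_induction _ IsUnit (fun a b ha hb => ha.mul hb) isUnit_one fun x hx => ?_
    obtain ⟨ha, hb, -, hpa, hpb⟩ := hA x hx
    exact ((hζU.pow _).mul (isUnit_one_sub_toInteger_pow hζ ha hpa)).mul
      (isUnit_one_sub_toInteger_pow hζ hb hpb)
  obtain ⟨u, hu⟩ := hU
  refine ⟨u, by rw [hu, hUK], ?_⟩
  rw [hu, hUK]
  -- reality through an embedding
  obtain ⟨φ⟩ := (inferInstance : Nonempty (K →+* ℂ))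
  obtain ⟨t, ht, hφt⟩ := exists_apply_eq_toCircle hζ φ
  apply φ.injective
  rw [IsCMField.complexEmbedding_complexConj]
  have hA' : ∀ x ∈ A, ¬ n ∣ x.1 ∧ ¬ n ∣ x.2.1 ∧ (2 * x.2.2 + x.1 + x.2.1) % (2 * n) = 0 := fun x hx =>
    ⟨(hA x hx).1, (hA x hx).2.1, (hA x hx).2.2.1⟩
  have him : ∀ x ∈ A, (φ (𝐮 x)).im = 0 := fun x hx =>
    (re_embedding_gen hφt ht (hA' x hx).1 (hA' x hx).2.1 (hA' x hx).2.2).2.2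
  have hreal : φ (∏ x ∈ A, 𝐮 x) = ((∏ x ∈ A, (φ (𝐮 x)).re : ℝ) : ℂ) := by
    rw [map_prod, Complex.ofReal_prod]
    exact Finset.prod_congr rfl fun x hx => Complex.ext (by simp) (by rw [Complex.ofReal_im]; exact him x hx)
  rw [map_mul, hreal]
  cases ε <;> simp [Complex.conj_ofReal]

end Summit.HodgeConjecture.Ring2WeilCoverage.CyclotomicUnitProducts

end
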